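import Summits.BirchSwinnertonDyer.BirchSwinnertonDyer.Theorems.KatoDescentPotSupersingularReducibleKatoMemberZetaInputsDescent
import Summits.BirchSwinnertonDyer.BirchSwinnertonDyer.Theorems.KatoDescentPotSupersingularMemberHullValueTightPin
import HarnessLib

/-!
# The member inequality T-X3K from a zeta package on ONE pin — with NO finiteness of `W(ℚ)` or `Ш(W)[p^∞]`
# (crux M `ReducibleKatoMember`, item stmt-BirchSwinnertonDyer-19196; seat `bsd-potss-rkm` g13; ROUTE-FREE)

rkm g12's `MemberHullValueTight.memberBound_of_memberHullZetaInputs` derives, on a cyclotomic pin carrying a zeta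
package `Z : Kato2004.MemberHullZetaInputs W p κ γ I 𝐲`, the member inequality
`∃ q, L(W,1)/Ω(W) = q ∧ ord_p #Ш(W)[p^∞] + v_p Tam(W) ≤ v_p q + 3·ord_p #W(ℚ)_tors` by PURE module theory — but
under the instance binders `[Finite W(ℚ)] [Finite Ш(W)[p^∞]]`, used only to restore the clause
`finite_coinvariants_H2` through (R0).  The sibling file `…ReducibleKatoMemberZetaInputsDescent` (this seat,
p549517) proves `finite_coinvariants_H2` from the package's own fields (`ZetaInputsDescent.finite_coinvariants_H2`:
Kato Thm. 12.5 (3) at `𝔭 = (γ − 1)` + Thm. 14.5 (2), Kato's own road to Thm. 14.5 (1)).  This file records the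
resulting binder-free form `memberBound_of_memberHullZetaInputs'` (same proof as g12's, the package
`Z.toMemberHullInputs hκ hγ (finite_coinvariants_H2 Z hκ hγ)` replacing the (R0)-built one) and the one-pin
consequence for the descent package: `natCard_coinvariants_H2_le_index` restated binder-free.

HONEST FRAMING: conditional on nothing beyond the displayed package `Z` (a hypothesis structure — the held fact
`exists_memberHullZetaInputs` asserts its inhabitation at Kato's member); nothing is booked; BSD is not advanced;
when `Ш(W)[p^∞]` is infinite the `Nat.card` term is the junk value `0` and the inequality is correspondingly weak
(as in every statement of this family).

References: K. Kato, Astérisque 295 (2004), Thm. 12.5 (3) (p. 222), Lemma 13.10 (1) (p. 230), 13.14 (p. 234),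
Thm. 14.5 (1)(2) (p. 236), (14.14.1)–(14.14.2) (p. 243), Prop. 14.16 (2) (p. 244) [Kato2004Asterisque];
C. Wuthrich, Doc. Math. 19 (2014) Lemma 14 [Wuthrich2014]; tree `HullDescentMultiplierProofs` (rkm g3),
`…MemberHullValueTightPin` (rkm g12), `…ReducibleKatoMemberZetaInputsDescent` (rkm g13).
-/

set_option autoImplicit false
-- sibling precedent (`…ReducibleKatoMemberOfInputs.lean`): the directory name repeats the summit name
set_option linter.dupNamespace false

noncomputable section

open scoped NumberField TensorProduct
open Field IsDedekindDomain CongruenceSubgroup Function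
open Literature.NumberTheory.GaloisRepresentations
open Literature.NumberTheory.EllipticCurves Literature.NumberTheory.EllipticCurves.ModularForms
open Literature.NumberTheory.EllipticCurves.Kato2004
open Literature.NumberTheory.EllipticCurves.Kato2004.EulerSystemValues Rat.HeightOneSpectrum
open Literature.NumberTheory.EllipticCurves.IwasawaAlgebra

namespace Summit.BirchSwinnertonDyer.BirchSwinnertonDyer.Theorems.ZetaInputsDescent

variable {W : WeierstrassCurve ℚ} [W.IsElliptic] {p : ℕ} [Fact p.Prime]
  [ContinuousSMul ℤ_[p] (W.tateModule p)] {κ : ZpExtension ℚ p} {γ : absoluteGaloisGroup ℚ}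
  {I : IwasawaH1Data W p κ γ} {y : I.H}

/-- **T-X3K's member inequality from a zeta package on one cyclotomic pin — NO finiteness binders**:
`∃ q, L(W,1)/Ω(W) = q ∧ ord_p #Ш(W)[p^∞] + v_p Tam(W) ≤ v_p q + 3·ord_p #W(ℚ)_tors` for every
`Z : MemberHullZetaInputs W p κ γ I 𝐲` (`κ` cyclotomic, `γ` a generator).  rkm g12's proof
(`valuation_add_padicValNat_coinvariants_le_of_hull_smul`: `v_p λ(0) + ord #(𝐇²/X𝐇²) ≤ ord [A : Λ·ι(ȳ)]`, then
the package's `count`) run on the full package `Z.toMemberHullInputs hκ hγ (finite_coinvariants_H2 Z hκ hγ)` —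
Kato Thm. 14.5 (1) now coming from the package itself (12.5 (3) at `(γ−1)` + 14.5 (2)), not from (R0)/GZK.
[cite: Kato2004Asterisque, Thm. 12.5 (3) (p. 222), Lemma 13.10 (1) (p. 230), Thm. 14.5 (1)(2) (p. 236), Prop. 14.16 (2) (p. 244)]
[cite: Wuthrich2014, Lemma 14 (p. 396)] -/
theorem memberBound_of_memberHullZetaInputs' (Z : MemberHullZetaInputs W p κ γ I y)
    (hκ : κ.IsCyclotomic) (hγ : κ.IsTopGenerator γ) :
    ∃ q : ℚ, W.entireLFunction 1 / (W.realPeriodRat : ℂ) = (q : ℂ) ∧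
      (padicValNat p (Nat.card (AddCommGroup.primaryComponent W.sha p)) : ℤ) +
          padicValNat p W.tamagawaProduct ≤
        padicValRat p q + 3 * (padicValNat p W.torsionOrder : ℤ) := by
  let K : MemberHullInputs W p κ γ I y := Z.toMemberHullInputs hκ hγ (finite_coinvariants_H2 Z hκ hγ)
  haveI := K.finite_H
  haveI := K.torsionFree_H
  haveI := K.finite_F
  haveI := K.torsionFree_F
  haveI := K.finite_H2
  -- the divisibility for the hull at EVERY height-one prime: off `(p)` Thm. 12.5 (3), at `(p)` `μ = 0`
  have hdiv : ∀ 𝔮 : PrimeSpectrum (IwasawaAlgebra p), 𝔮.asIdeal.height = 1 →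
      Module.lengthAt (IwasawaAlgebra p) K.H2 𝔮 ≤
        Module.lengthAt (IwasawaAlgebra p) (K.F ⧸ (IwasawaAlgebra p) ∙ K.z) 𝔮 := by
    intro 𝔮 h𝔮
    by_cases hq : 𝔮.asIdeal = augIdealP p
    · have hμ : (Module.lengthAt (IwasawaAlgebra p) K.H2 𝔮).toNat = 0 := by
        rw [← muInvariant_eq_toNat_lengthAt p K.H2 𝔮 hq]; exact K.mu_H2
      have hfinl : Module.lengthAt (IwasawaAlgebra p) K.H2 𝔮 ≠ ⊤ :=
        IwasawaAlgebra.lengthAt_ne_top_of_isTorsion K.H2 K.isTorsion_H2 𝔮 (le_of_eq h𝔮)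
      have h0' : Module.lengthAt (IwasawaAlgebra p) K.H2 𝔮 = 0 := by
        rw [← ENat.coe_toNat hfinl, hμ]; rfl
      rw [h0']
      exact bot_le
    · exact K.divisibility_offP 𝔮 h𝔮 hq
  have hhull := valuation_add_padicValNat_coinvariants_le_of_hull_smul K.j K.j_injective
    K.finite_coker K.z K.z_ne_zero K.isTorsion_quotient K.isTorsion_H2 hdiv y K.lam
    K.lam_constantCoeff_ne_zero K.j_y K.ι K.π K.ι_injective K.π_surjective K.exact_ι_π
    K.finite_coinvariants_H2 K.index_ne_zero
  obtain ⟨q, hq, hcount⟩ := K.count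
  refine ⟨q, hq, ?_⟩
  have hhull' : ((PowerSeries.constantCoeff K.lam).valuation : ℤ) +
      (padicValNat p (Nat.card (coinvariants p K.H2)) : ℤ) ≤
      (padicValNat p (Nat.card (K.A ⧸ (IwasawaAlgebra p) ∙ K.ι (Submodule.Quotient.mk y))) : ℤ) := by
    exact_mod_cast hhull
  linarith

/-- **The hull-descent inequality on one pin, binder-free**: `v_p λ(0) + ord_p #(𝐇²/X𝐇²) ≤ ord_p [A : Λ·ι(ȳ)]`
for every zeta package over a cyclotomic pin (Kato Lemma 13.10 (1) multiplier + (14.14.1) descent + Thm. 12.5 (3)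
+ `μ = 0`; rkm g3's `valuation_add_padicValNat_coinvariants_le_of_hull_smul` with Thm. 14.5 (1) supplied by
`finite_coinvariants_H2`). [cite: Kato2004Asterisque, Lemma 13.10 (1) (p. 230), Thm. 12.5 (3) (p. 222), (14.14.1) (p. 243)]
[cite: Wuthrich2014, Lemma 14 (p. 396)] -/
theorem valuation_add_natCard_coinvariants_H2_le_index (Z : MemberHullZetaInputs W p κ γ I y)
    (hκ : κ.IsCyclotomic) (hγ : κ.IsTopGenerator γ) :
    (PowerSeries.constantCoeff Z.lam).valuation + padicValNat p (Nat.card (coinvariants p Z.H2)) ≤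
      padicValNat p (Nat.card (Z.A ⧸ (IwasawaAlgebra p) ∙ Z.ι (Submodule.Quotient.mk y))) := by
  let K : MemberHullInputs W p κ γ I y := Z.toMemberHullInputs hκ hγ (finite_coinvariants_H2 Z hκ hγ)
  haveI := K.finite_H
  haveI := K.torsionFree_H
  haveI := K.finite_F
  haveI := K.torsionFree_F
  haveI := K.finite_H2
  have hdiv : ∀ 𝔮 : PrimeSpectrum (IwasawaAlgebra p), 𝔮.asIdeal.height = 1 →
      Module.lengthAt (IwasawaAlgebra p) K.H2 𝔮 ≤
        Module.lengthAt (IwasawaAlgebra p) (K.F ⧸ (IwasawaAlgebra p) ∙ K.z) 𝔮 := by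
    intro 𝔮 h𝔮
    by_cases hq : 𝔮.asIdeal = augIdealP p
    · have hμ : (Module.lengthAt (IwasawaAlgebra p) K.H2 𝔮).toNat = 0 := by
        rw [← muInvariant_eq_toNat_lengthAt p K.H2 𝔮 hq]; exact K.mu_H2
      have hfinl : Module.lengthAt (IwasawaAlgebra p) K.H2 𝔮 ≠ ⊤ :=
        IwasawaAlgebra.lengthAt_ne_top_of_isTorsion K.H2 K.isTorsion_H2 𝔮 (le_of_eq h𝔮)
      have h0' : Module.lengthAt (IwasawaAlgebra p) K.H2 𝔮 = 0 := by
        rw [← ENat.coe_toNat hfinl, hμ]; rfl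
      rw [h0']
      exact bot_le
    · exact K.divisibility_offP 𝔮 h𝔮 hq
  exact valuation_add_padicValNat_coinvariants_le_of_hull_smul K.j K.j_injective
    K.finite_coker K.z K.z_ne_zero K.isTorsion_quotient K.isTorsion_H2 hdiv y K.lam
    K.lam_constantCoeff_ne_zero K.j_y K.ι K.π K.ι_injective K.π_surjective K.exact_ι_π
    K.finite_coinvariants_H2 K.index_ne_zero

end Summit.BirchSwinnertonDyer.BirchSwinnertonDyer.Theorems.ZetaInputsDescent

end
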